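import Mathlib

/-!
# Route «KPlusLogSqLaw», crux `TropicalB` / `WeakLifting` — the DONATION BUDGET: a transversal-merging process on `R` regions gains at most
# `2·T·s + R` over `T` steps whenever `R ≤ s²` (the combinatorial half of the `T^{3/2}` ceiling for width-two walk systems)

HONEST FRAMING.  Helper lemma (cell `pub-symmetroid`, seat val-sym-lift-p3 g24, 2026-08-29) for the WALK-DESIGN route of the `K = 4` growth fork
(D2) of route `KPlusLogSqLaw` (cruxes `Summit.ValiantsHypothesis.ValiantsHypothesis.Theses.KPlusLogSqLaw.TropicalB`, stmt-ValiantsHypothesis-19771, and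
`…WeakLifting`, stmt-ValiantsHypothesis-19561).  CONTEXT (located, on paper; nothing of it is asserted here): for width-two layered walk systems
(kernel structure `…TropicalBWalkWidthTwo`, p501758; Gusfield's `4^⌈log₂T⌉` bound `…TropicalBWalkGusfield`, p490642; CONJECTURE W2 «linear in T»,
memo HOME/val-sym-trop-p1/g5/WALK-WIDTH-g5.md §3.4′–3.4‴) the excess junctions that a ceiling can later harvest as twins grow only by single-corner
oblique clips, at most ONE per «class» per layer (a class = the regions whose bottom plateau lies on the same earlier barrier line; two lines cross
once), after which the clipped regions form one NEW class.  Granting that geometric reduction, the number of twins is controlled by the following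
purely combinatorial process, and this file proves its budget (memo HOME/val-sym-lift-p3/g24/W2-UPPERHULL-liftp3g24.md §5b):

THE PROCESS.  `R` regions carry class labels `cls t : Fin R → ℕ` at times `t = 0, 1, …`.  At each step every region that changes its label
receives one common FRESH label (no region carried it before the step), and a set `D t` of «donors» — regions that change label and whose OLD labels
are pairwise distinct (at most one donor per old class) — is credited.
THE BUDGET (`DonationBudget.sum_card_le`).  If `R ≤ s·s` then `∑_{t<T} #(D t) ≤ 2·T·s + R`.
Proof: the potential `Ψ(f) = ∑_{classes c} min(#c, s) ∈ [0, R]` drops by at least one for every donor class of size `≤ s` and rises by at most `s`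
(the new class); classes of size `> s` number `< R/(s+1) ≤ s`; so per step `#D + Ψ' ≤ 2s + Ψ` (`card_add_psi_le`) and the sum telescopes.
With `R = O(T)` regions (width two: regions ≤ alternations + 1 ≤ 2T + 1) this is the `O(T^{3/2})` count; the geometric half is NOT in the kernel and
NOT claimed.  Nothing here bears on `TropicalB` in its window, `WeakLifting`, `MatrixDescartes` (stmt-ValiantsHypothesis-18050) or `VP ≠ VNP`.
[folklore] elementary double counting.
-/

set_option linter.dupNamespace false
set_option autoImplicit false

namespace Summit.ValiantsHypothesis.ValiantsHypothesis.Theorems.KPlusLogSqLaw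

namespace DonationBudget

open Finset

variable {R : ℕ}

/-! Throughout, the SIZE of the class with label `c` under a labelling `f : Fin R → ℕ` is `#(univ.filter (f · = c))`, and the POTENTIAL is
`Ψ(f) = ∑ c ∈ univ.image f, min (size c) s`; both are written out in full (no definitions). -/

/-- the class sizes over the labels in use add up to `R`. [folklore] -/
theorem sum_size_eq (f : Fin R → ℕ) : ∑ c ∈ univ.image f, (univ.filter fun i => f i = c).card = R := by
  rw [← Finset.card_eq_sum_card_fiberwise (fun i hi => mem_image_of_mem f hi)]
  simp

/-- the potential is at most `R`. [folklore] -/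
theorem psi_le (f : Fin R → ℕ) (s : ℕ) : (∑ c ∈ univ.image f, min ((univ.filter fun i => f i = c).card) s) ≤ R := by
  calc ∑ c ∈ univ.image f, min ((univ.filter fun i => f i = c).card) s ≤ ∑ c ∈ univ.image f, (univ.filter fun i => f i = c).card := sum_le_sum fun c _ => min_le_left _ _
    _ = R := sum_size_eq f

/-- fewer than `s + 1` classes can have more than `s` members when `R ≤ s·s`. [folklore] -/
theorem card_big_le (f : Fin R → ℕ) (s : ℕ) (hs : R ≤ s * s) :
    ((univ.image f).filter fun c => s < (univ.filter fun i => f i = c).card).card ≤ s := by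
  by_contra h
  push Not at h
  have h1 : ((univ.image f).filter fun c => s < (univ.filter fun i => f i = c).card).card * (s + 1) ≤ ∑ c ∈ univ.image f, (univ.filter fun i => f i = c).card := by
    calc ((univ.image f).filter fun c => s < (univ.filter fun i => f i = c).card).card * (s + 1)
        = ∑ c ∈ (univ.image f).filter (fun c => s < (univ.filter fun i => f i = c).card), (s + 1) := by rw [sum_const, smul_eq_mul]
      _ ≤ ∑ c ∈ (univ.image f).filter (fun c => s < (univ.filter fun i => f i = c).card), (univ.filter fun i => f i = c).card :=
          sum_le_sum fun c hc => (mem_filter.mp hc).2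
      _ ≤ ∑ c ∈ univ.image f, (univ.filter fun i => f i = c).card := sum_le_sum_of_subset_of_nonneg (filter_subset _ _) fun _ _ _ => Nat.zero_le _
  rw [sum_size_eq] at h1
  have h2 : (s + 1) * (s + 1) ≤ R := le_trans (Nat.mul_le_mul_right _ h) h1
  nlinarith

/-- **One step of the process: `#D + Ψ(after) ≤ 2s + Ψ(before)`.**  `f` = labels before, `g` = labels after, `ℓ` = the fresh common label of
all regions that changed, `D` = donors (changed, old labels pairwise distinct). [folklore] -/
theorem card_add_psi_le (f g : Fin R → ℕ) (ℓ : ℕ) (s : ℕ) (hs : R ≤ s * s) (hfresh : ∀ i, f i ≠ ℓ)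
    (hnew : ∀ i, g i ≠ f i → g i = ℓ) (D : Finset (Fin R)) (hD : ∀ i ∈ D, g i ≠ f i) (hinj : Set.InjOn f D) :
    D.card + (∑ c ∈ univ.image g, min ((univ.filter fun i => g i = c).card) s) ≤ 2 * s + (∑ c ∈ univ.image f, min ((univ.filter fun i => f i = c).card) s) := by
  classical
  -- (1) old classes only lose members
  have hsub : ∀ c, c ≠ ℓ → (univ.filter fun i => g i = c) ⊆ (univ.filter fun i => f i = c) := by
    intro c hc i hi
    rw [mem_filter] at hi ⊢
    refine ⟨hi.1, ?_⟩
    by_contra hne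
    have := hnew i (by rw [hi.2]; exact fun h => hne h.symm)
    exact hc (hi.2.symm.trans this)
  have hle : ∀ c, c ≠ ℓ → (univ.filter fun i => g i = c).card ≤ (univ.filter fun i => f i = c).card := fun c hc => card_le_card (hsub c hc)
  -- (2) donor classes lose at least one member
  have hlt : ∀ i ∈ D, (univ.filter fun j => g j = f i).card + 1 ≤ (univ.filter fun j => f j = f i).card := by
    intro i hi
    have hc : f i ≠ ℓ := hfresh i
    have hss : (univ.filter fun j => g j = f i) ⊂ (univ.filter fun j => f j = f i) := by
      refine ⟨hsub _ hc, fun h => ?_⟩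
      have : i ∈ univ.filter fun j => g j = f i := h (by simp)
      exact hD i hi (mem_filter.mp this).2
    exact Nat.succ_le_of_lt (card_lt_card hss)
  -- (3) the new labels are old labels or `ℓ`
  have himg : univ.image g ⊆ insert ℓ (univ.image f) := by
    intro c hc
    obtain ⟨i, -, rfl⟩ := mem_image.mp hc
    by_cases h : g i = f i
    · exact mem_insert_of_mem (mem_image.mpr ⟨i, mem_univ _, h.symm⟩)
    · rw [hnew i h]; exact mem_insert_self _ _
  have hℓ : ℓ ∉ univ.image f := by
    intro h; obtain ⟨i, -, hi⟩ := mem_image.mp h; exact hfresh i hi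
  -- Ψ(g) ≤ s + ∑_{c ∈ image f} min ((univ.filter fun i => g i = c).card) s
  have hpsi_g : (∑ c ∈ univ.image g, min ((univ.filter fun i => g i = c).card) s) ≤ s + ∑ c ∈ univ.image f, min ((univ.filter fun i => g i = c).card) s := by
      calc ∑ c ∈ univ.image g, min ((univ.filter fun i => g i = c).card) s
        ≤ ∑ c ∈ insert ℓ (univ.image f), min ((univ.filter fun i => g i = c).card) s :=
          sum_le_sum_of_subset_of_nonneg himg fun _ _ _ => Nat.zero_le _
      _ = min ((univ.filter fun i => g i = ℓ).card) s + ∑ c ∈ univ.image f, min ((univ.filter fun i => g i = c).card) s := sum_insert hℓ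
      _ ≤ s + ∑ c ∈ univ.image f, min ((univ.filter fun i => g i = c).card) s := Nat.add_le_add_right (min_le_right _ _) _
  -- the donor classes, split by size
  set small := (D.image f).filter fun c => (univ.filter fun i => f i = c).card ≤ s with hsmall
  set big := (D.image f).filter fun c => s < (univ.filter fun i => f i = c).card with hbig
  have hDcard : D.card = small.card + big.card := by
    rw [← card_image_of_injOn hinj, hsmall, hbig]
    rw [← Finset.card_filter_add_card_filter_not (s := D.image f) (fun c => (univ.filter fun i => f i = c).card ≤ s)]
    congr 2
    ext c; simp [not_le]
  have hbig_le : big.card ≤ s := by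
    refine le_trans (card_le_card ?_) (card_big_le f s hs)
    intro c hc
    rw [hbig, mem_filter] at hc
    rw [mem_filter]
    refine ⟨?_, hc.2⟩
    obtain ⟨i, -, rfl⟩ := mem_image.mp hc.1
    exact mem_image_of_mem f (mem_univ i)
  -- (4) ∑_{image f} min(size g, s) + #small ≤ ∑_{image f} min(size f, s)
  have hkey : ∑ c ∈ univ.image f, min ((univ.filter fun i => g i = c).card) s + small.card ≤ ∑ c ∈ univ.image f, min ((univ.filter fun i => f i = c).card) s := by
    have hsm_sub : small ⊆ univ.image f := by
      intro c hc
      rw [hsmall, mem_filter] at hc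
      obtain ⟨i, -, rfl⟩ := mem_image.mp hc.1
      exact mem_image_of_mem f (mem_univ i)
    have h1 : small.card = ∑ c ∈ univ.image f, if c ∈ small then 1 else 0 := by
      rw [← Finset.sum_filter, Finset.filter_mem_eq_inter, Finset.inter_eq_right.mpr hsm_sub, Finset.card_eq_sum_ones]
    rw [h1, ← sum_add_distrib]
    refine sum_le_sum fun c hc => ?_
    by_cases hcs : c ∈ small
    · rw [if_pos hcs]
      rw [hsmall, mem_filter] at hcs
      obtain ⟨i, hiD, rfl⟩ := mem_image.mp hcs.1
      have h2 := hlt i hiD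
      have h3 : (univ.filter fun j => g j = f i).card ≤ s := by omega
      rw [min_eq_left h3, min_eq_left hcs.2]
      exact h2
    · rw [if_neg hcs, add_zero]
      have hcℓ : c ≠ ℓ := fun h => hℓ (h ▸ hc)
      exact min_le_min_right s (hle c hcℓ)
  omega

/-- **THE DONATION BUDGET.**  Labels `cls t : Fin R → ℕ` (`t ≤ T`); at each step `t < T` all changed regions get one common fresh label, and the
donors `D t` are changed regions with pairwise distinct old labels.  If `R ≤ s·s` then `∑_{t<T} #(D t) ≤ 2·T·s + R`. [folklore] -/
theorem sum_card_le (T s : ℕ) (hs : R ≤ s * s) (cls : ℕ → Fin R → ℕ) (D : ℕ → Finset (Fin R))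
    (hstep : ∀ t < T, ∃ ℓ : ℕ, (∀ i, cls t i ≠ ℓ) ∧ (∀ i, cls (t + 1) i ≠ cls t i → cls (t + 1) i = ℓ))
    (hD : ∀ t < T, ∀ i ∈ D t, cls (t + 1) i ≠ cls t i) (hinj : ∀ t < T, Set.InjOn (cls t) (D t)) :
    ∑ t ∈ range T, (D t).card ≤ 2 * T * s + R := by
  -- telescope `∑_{t<T} #D t + Ψ(cls T) ≤ 2 s T + Ψ(cls 0)`
  have htel : ∀ T' ≤ T, ∑ t ∈ range T', (D t).card + (∑ c ∈ univ.image (cls T'), min ((univ.filter fun i => (cls T') i = c).card) s) ≤ 2 * T' * s + (∑ c ∈ univ.image (cls 0), min ((univ.filter fun i => (cls 0) i = c).card) s) := by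
    intro T' hT'
    induction T' with
    | zero => simp
    | succ T' ih =>
      have ih' := ih (by omega)
      obtain ⟨ℓ, hfresh, hnew⟩ := hstep T' (by omega)
      have hst := card_add_psi_le (cls T') (cls (T' + 1)) ℓ s hs hfresh hnew (D T') (hD T' (by omega)) (hinj T' (by omega))
      rw [sum_range_succ]
      nlinarith
  have h := htel T le_rfl
  have h0 := psi_le (cls 0) s
  omega

end DonationBudget

end Summit.ValiantsHypothesis.ValiantsHypothesis.Theorems.KPlusLogSqLaw
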